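import Literature.Geometry.Lorentzian.KerrPhotonShellSphericalOrbits
import Literature.Geometry.Lorentzian.KerrRadiusHessianChart
import HarnessLib

/-!
# Inside the photon shell the Kerr cylinders are not pseudo-convex from either side

(family `gr`; namespace `Literature.Geometry.Lorentzian.Kerr[.Ingoing]`; sequel to
`KerrPhotonShellSphericalOrbits.lean` and `KerrRadiusPseudoconvexity.lean`.)

The geometric form of the sharpness of the photon shell: **at every EQUATORIAL point of a cylinder
`{r = c}` with `c` in the closed shell `[r_ph⁺, r_ph⁻]` of sub-extremal Kerr there is a non-zero
null vector tangent to the cylinder with `Hess r(w, w) = 0`** — the velocity of Teo's spherical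
photon orbit through that point (`exists_null_tangent_hessR_eq_zero` in the ingoing chart,
`exists_null_tangent_hessAt_eq_zero` in Kerr–Schild Cartesian coordinates). So no such cylinder
is strongly null pseudo-convex (Ionescu–Klainerman, Def. 1.1) towards `{r < c}` nor towards
`{r > c}`: the two sweeps of `KerrRadiusPseudoconvexity(KS).lean` stop exactly at the shell.

Construction: take constants `(1, L, Q)` with `Q ≥ 0`, `R(c) = R′(c) = 0`
(`exists_spherical_constants`); at an equatorial chart point (`μ = 0`) solve the `(t*, φ)` block
(determinant `Δ ≠ 0`) for `(w⁰, w^φ)` with energy `1` and angular momentum `L`, put `wʳ = 0` and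
`w^μ = √Q/c²` (so that the Carter constant of `w` is `Q`); then the radial identity gives
`g(w,w) = −R(c)/(ΣΔ) = 0` and the acceleration identity gives `Hess r(w,w) = R′(c)/(2Σ²) = 0`.

## References

* E. Teo, Gen. Relativity Gravitation 35 (2003) 1909–1926, §2.
* A. D. Ionescu, S. Klainerman, J. Amer. Math. Soc. 26 (2013) 563–593, Def. 1.1.
-/

noncomputable section

set_option maxSynthPendingDepth 3

open Set Real
open Literature.Geometry.Lorentzian.MetricCoord

namespace Literature.Geometry.Lorentzian

namespace Kerr

/-- **Explicit spherical-orbit constants with `E = 1` and `Q ≥ 0`** on the closed shell: for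
`0 < M`, `|a| < M`, `r_ph⁺ ≤ c ≤ r_ph⁻` there are `L` and `Q ≥ 0` with `R(c; 1, L, Q) = 0` and
`R′(c; 1, L, Q) = 0` (Teo's `(λ(c), η(c))`; `(0, 27M²)` at the photon sphere when `a = 0`).
[cite: Teo2003, §2] -/
theorem exists_spherical_constants {M a c : ℝ} (hM : 0 < M) (ha : |a| < M)
    (h₁ : photonOrbitRadius M (-|a|) ≤ c) (h₂ : c ≤ photonOrbitRadius M |a|) :
    ∃ L Q : ℝ, 0 ≤ Q ∧ nullRadialPotential M a 1 L Q c = 0 ∧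
      deriv (nullRadialPotential M a 1 L Q) c = 0 := by
  by_cases ha0 : a = 0
  · subst ha0
    have h3 : photonOrbitRadius M 0 = 3 * M := by
      have h := photonOrbit_p_eq_zero_of_abs_le hM (x := 0) (by simpa using hM.le)
      have hge : 3 * M ≤ photonOrbitRadius M 0 := (photonOrbitRadius_mem hM le_rfl).1
      have hpos : 0 < photonOrbitRadius M 0 := by linarith
      have : (photonOrbitRadius M 0 - 3 * M) ^ 2 = 0 := by
        have h' : photonOrbitRadius M 0 * (photonOrbitRadius M 0 - 3 * M) ^ 2 = 0 := by
          simpa using h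
        rcases mul_eq_zero.1 h' with h0 | h0
        · exact absurd h0 hpos.ne'
        · exact h0
      nlinarith [sq_nonneg (photonOrbitRadius M 0 - 3 * M)]
    simp only [abs_zero, neg_zero, h3] at h₁ h₂
    have hc : c = 3 * M := le_antisymm h₂ h₁
    subst hc
    refine ⟨0, 27 * M ^ 2, by positivity, ?_, ?_⟩
    · unfold nullRadialPotential; ring
    · rw [deriv_nullRadialPotential]; ring
  · have hMc : M < c := by
      have := (photonOrbitRadius_neg_mem hM (by linarith [abs_nonneg a]) (by
        linarith [abs_nonneg a] : -|a| ≤ 0)).1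
      linarith
    have hc : c ≠ M := hMc.ne'
    have hc0 : 0 < c := hM.trans hMc
    have hp := photonCubic_nonpos_of_mem_photonShell hM ha.le h₁ h₂
    exact ⟨sphericalImpact M a c, sphericalCarter M a c, sphericalCarter_nonneg ha0 hc hc0 hp,
      nullRadialPotential_spherical ha0 hc, deriv_nullRadialPotential_spherical ha0 hc⟩

namespace Ingoing

/-- **At an equatorial point of a shell cylinder there is a non-zero null tangent vector with
vanishing radial acceleration** (ingoing chart). For `0 < M`, `|a| < M`, a chart point `u` with
`μ = u² = 0` and `r = u¹` in the closed photon shell: some `w ≠ 0` with `wʳ = 0`, `g_u(w,w) = 0`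
and `hessR(u, w) = Hess r(w,w) = 0` — the velocity of the spherical photon orbit of radius `u¹`
through `u`. Hence `{r = u¹}` is strongly null pseudo-convex from NEITHER side there.
[cite: Teo2003, §2] -/
theorem exists_null_tangent_hessR_eq_zero {M a : ℝ} (hM : 0 < M) (ha : |a| < M) {u : E4}
    (h₁ : photonOrbitRadius M (-|a|) ≤ u 1) (h₂ : u 1 ≤ photonOrbitRadius M |a|) (hμ : u 2 = 0) :
    ∃ w : E4, w ≠ 0 ∧ w 1 = 0 ∧ bilin M a u w w = 0 ∧ hessR M a u w = 0 := by
  obtain ⟨L, Q, hQ, hR, hR'⟩ := exists_spherical_constants hM ha h₁ h₂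
  -- the point is regular and off the horizons
  have hMc : M < u 1 := by
    have := (photonOrbitRadius_neg_mem hM (by linarith [abs_nonneg a]) (by
      linarith [abs_nonneg a] : -|a| ≤ 0)).1
    linarith
  have hrp : rPlus M a < u 1 := by
    have h := rPlus_add_le_photonOrbitRadius_neg (χ := |a| / M) hM (div_nonneg (abs_nonneg a) hM.le)
      (show |a| / M < 1 by rw [div_lt_one hM]; exact ha)
      (show |a| ≤ |a| / M * M by rw [div_mul_cancel₀ _ hM.ne'])
    have hgap : 0 < M * (1 - (|a| / M) ^ 2) / 3 := by
      have : (|a| / M) ^ 2 < 1 := by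
        have h0 : 0 ≤ |a| / M := div_nonneg (abs_nonneg a) hM.le
        have h1 : |a| / M < 1 := by rw [div_lt_one hM]; exact ha
        nlinarith
      have : 0 < 1 - (|a| / M) ^ 2 := by linarith
      positivity
    linarith
  have hμ2 : u 2 ^ 2 < 1 := by rw [hμ]; norm_num
  have hu : u ∈ regularSet a := mem_regularSet_of_rPlus_lt hM hrp hμ2
  have hS := hu.1
  have hΔ : 0 < u 1 ^ 2 - 2 * M * u 1 + a ^ 2 := delta_pos_of_rPlus_lt ha.le hrp
  -- solve the `(t*, φ)` block for energy `1` and angular momentum `L`, and set `w^μ = √Q / c²`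
  set D : ℝ := (1 - h00 M a u) * c33 M a u + h03 M a u ^ 2 with hD
  have hDval : D = sinSq u * (u 1 ^ 2 - 2 * M * u 1 + a ^ 2) := one_sub_h00_mul_c33_add_sq hS
  have hsin : sinSq u = 1 := by unfold sinSq; rw [hμ]; norm_num
  have hD0 : D ≠ 0 := by rw [hDval, hsin, one_mul]; exact hΔ.ne'
  set w0 : ℝ := (c33 M a u * 1 + h03 M a u * L) / D with hw0
  set w3 : ℝ := ((1 - h00 M a u) * L - h03 M a u * 1) / D with hw3
  set w2 : ℝ := √Q / sigma a u with hw2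
  set w : E4 := !₂[w0, 0, w2, w3] with hw
  have hw_0 : w 0 = w0 := by simp [hw]
  have hw_1 : w 1 = 0 := by simp [hw]
  have hw_2 : w 2 = w2 := by simp [hw]
  have hw_3 : w 3 = w3 := by simp [hw]
  -- its constants are `(1, L, Q)`
  have hE : energy M a u w = 1 := by
    rw [energy_eq, hw_0, hw_1, hw_3, hw0, hw3]
    field_simp
    ring
  have hL : angMom M a u w = L := by
    rw [angMom_eq, hw_0, hw_1, hw_3, hw0, hw3]
    field_simp
    ring
  have hQw : carterQ M a u w = Q := by
    unfold carterQ
    rw [hE, hL, hw_2, hw2, hsin, hμ]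
    have hS' : sigma a u ≠ 0 := hS
    field_simp
    rw [sq_sqrt hQ]
    ring
  -- null by the radial identity, zero acceleration by the acceleration identity
  have hI := sq_sigma_mul_sq_sub_nullRadialPotential (M := M) hu w
  rw [hE, hL, hQw, hw_1, hR] at hI
  have hnull : bilin M a u w w = 0 := by
    have h0 : sigma a u * (u 1 ^ 2 - 2 * M * u 1 + a ^ 2) * bilin M a u w w = 0 := by
      rw [← hI]; ring
    rcases mul_eq_zero.1 h0 with h | h
    · rcases mul_eq_zero.1 h with h' | h'
      · exact absurd h' hS
      · exact absurd h' hΔ.ne'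
    · exact h
  have hII := two_mul_sq_sigma_mul_hessR_sub_deriv (M := M) hu hw_1
  rw [hE, hL, hQw, hR', hnull, mul_zero, sub_zero] at hII
  have hhess : hessR M a u w = 0 := by
    have h2S : 2 * sigma a u ^ 2 ≠ 0 := by positivity
    rcases mul_eq_zero.1 hII with h | h
    · exact absurd h h2S
    · exact h
  refine ⟨w, ?_, hw_1, hnull, hhess⟩
  intro h0
  have : energy M a u w = 0 := by rw [h0]; unfold energy; simp
  rw [hE] at this
  exact one_ne_zero this

end Ingoing

/-- **At an equatorial Kerr–Schild point of a shell cylinder there is a non-zero null tangent vector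
with `Hess r(w,w) = 0`** (Kerr–Schild Cartesian coordinates, via the chart): for `0 < M`,
`|a| < M`, `u` an equatorial chart point (`u² = 0`) with `u¹` in the closed photon shell, at
`z = Ψ u` some `w ≠ 0` is null for `Kerr.bilin M a`, tangent to `{r = r(z)}` and has
`hessAt (Kerr.bilin M a) (Kerr.radius a) z w w = 0`. Consequently the cylinders `{r = c}`,
`c ∈ [r_ph⁺, r_ph⁻]`, are strongly null pseudo-convex from neither side: the stopping radii of
`Kerr.hessAt_radius_neg` / `Kerr.hessAt_radius_pos` are sharp. [cite: IonescuKlainerman2012, Def. 1.1] -/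
theorem exists_null_tangent_hessAt_eq_zero {M a r₀ : ℝ} (hM : 0 < M) (ha : |a| < M) {u : E4}
    (hu : u ∈ Ingoing.coordDomain r₀) (h₁ : photonOrbitRadius M (-|a|) ≤ u 1)
    (h₂ : u 1 ≤ photonOrbitRadius M |a|) (hμ : u 2 = 0) :
    ∃ w : E4, w ≠ 0 ∧ Kerr.bilin M a (Ingoing.chartFun a r₀ u) w w = 0 ∧
      fderiv ℝ (radius a) (Ingoing.chartFun a r₀ u) w = 0 ∧
      hessAt (Kerr.bilin M a) (radius a) (Ingoing.chartFun a r₀ u) w w = 0 := by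
  obtain ⟨v, hv, hv1, hnull, hhess⟩ := Ingoing.exists_null_tangent_hessR_eq_zero hM ha h₁ h₂ hμ
  refine ⟨Ingoing.jac a u v, ?_, ?_, ?_, ?_⟩
  · intro h0
    exact hv (Ingoing.jac_injective (a := a) hu (by rw [h0, map_zero]))
  · rw [Ingoing.kerrBilin_jac hu]; exact hnull
  · rw [Ingoing.fderiv_radius_chartFun_jac hu]; exact hv1
  · rw [Ingoing.hessAt_bilin_radius_chartFun_self hu]; exact hhess

end Kerr

end Literature.Geometry.Lorentzian

end
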